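import Literature.Analysis.Fourier.FractalUncertaintyStep
import Literature.Analysis.Fourier.FractalUncertaintyKernel
import Literature.Analysis.Fourier.FractalUncertaintyPrincipleProofs
import Mathlib.Analysis.SpecialFunctions.Log.Base
import HarnessLib

/-!
# BD18 Theorem 4 from Proposition 3.1: the iteration argument of §3.4, proved

Topic `Literature/Analysis/Fourier`. J. Bourgain, S. Dyatlov, *Spectral gaps without the pressure
condition*, Ann. of Math. 187 (2018). The named fact `bourgainDyatlov2018_thm4`
(`FractalUncertaintyPrinciple.lean`) is Theorem 4 there (fractal uncertainty principle for
`δ`-regular `X, Y`, `0 ≤ δ < 1`). Its printed proof has two analytic inputs that present-day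
Mathlib cannot support — the Beurling–Malliavin multiplier theorem (BD18 Thm 5 / Lemma 2.11) and
harmonic-measure estimates on slit strips (BD18 §2.4, Lemma 3.2) — both of which enter ONLY through

> **BD18 Proposition 3.1** (unique continuation for Fourier support in a regular set). Let
> `Y ⊂ [-α₁, α₁]` be `δ`-regular with constant `C_R` on scales `1` to `α₁`, `0 < δ < 1`, and for
> each `j ∈ ℤ` let `I'_j ⊂ [j, j+1]` be a subinterval of size `c₁ > 0`; `U' = ⋃ I'_j`. Then there is
> `c₃ > 0` depending only on `δ, C_R, c₁` such that `‖f‖_{L²(U')} ≥ c₃ ‖f‖_{L²(ℝ)}` for all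
> `f ∈ L²(ℝ)` with `supp f̂ ⊂ Y`.

This file proves, sorry-free, the remaining implication **Proposition 3.1 ⇒ Theorem 4**, i.e. the
whole of BD18 §3.4 (the iteration on scales, Lemmas 3.4–3.5, with the regular-set combinatorics of
§2.2 and the case `δ < 1/2`): `bourgainDyatlov2018_thm4_of_prop31 (H : «Prop 3.1») : bourgainDyatlov2018_thm4`.
Proposition 3.1 enters as the explicit hypothesis `H`, written — like the fact — for `f = 𝓕⁻ h`,
`h ∈ L¹ ∩ L²` vanishing off `Y` (so `‖f‖_{L²} = ‖h‖_{L²}` by Plancherel), with the intervals `I'_j`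
given by their centres `t j`, and squared: `c₃ ‖h‖² ≤ ‖𝓕⁻ h‖²_{L²(U')}` (equivalent to the printed
form with `c₃ ↦ c₃²`). No new named fact is introduced (D-0026): `H` is a hypothesis of a
theorem.

* `iteration_many` — `m` steps of BD18 Lemma 3.5 (via `iteration_step`): functions `g_m` with
  `𝓕⁻ g_m = (∏ Ψ) 𝓕⁻ g`, `|𝓕⁻ g_m| ≥ m_T^m |𝓕⁻ g|` on `X`, `‖𝓕⁻ g_m‖² ≤ κ^m ‖g‖²`;
* `bourgainDyatlov2018_thm4_of_prop31` — the choice of `L = ⌈(3C_R)^{2/(1-δ)}⌉`, of `T` (kernel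
  tails), of `m ~ log N / ((T+1) log L)`, and `β = -log θ₀ / (2 (T+1) log L)`, `C = θ₀⁻¹`.
-/

namespace Literature.Analysis.Fourier

open _root_.MeasureTheory Set Function Filter
open scoped FourierTransform ENNReal Convolution Pointwise Real Topology

/-- **`m` iterations of BD18 Lemma 3.5** (proof of Theorem 4, §3.4: "`f_m := (∏_{ℓ<m} Ψ_{ℓT}) f`,
`‖f_m‖ ≤ (1-τ)^{m-1}‖f‖`, `supp f̂_m ⊂ Y(2L^{mT})`", together with the lower bound of Lemma 3.4 on
`X`), from the Prop-3.1 hypothesis `H`, in the `g`-language. Steps happen at the levels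
`n = (T+1), 2(T+1), …`. [cite: BourgainDyatlov2018, §3.4, proof of Theorem 4] -/
theorem iteration_many
    {δ C_R c₃ N : ℝ} {L T : ℕ} {X Y : Set ℝ} {φ : ℝ → ℝ} {u : ℝ → ℂ} {g : ℝ → ℂ}
    (hδ0 : 0 ≤ δ) (hδ1 : δ < 1) (hC : 1 ≤ C_R) (hL2 : 2 ≤ L)
    (hLreg : (3 * C_R) ^ (2 / (1 - δ)) ≤ (L : ℝ))
    (hXreg : IsRegularSet X δ C_R N⁻¹ 1) (hX : X ⊆ Icc (-1) 1)
    (hYreg : IsRegularSet Y δ C_R 1 N) (hY : Y ⊆ Icc (-N) N)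
    (hφ0 : ∀ x, 0 ≤ φ x) (hφi : Integrable φ) (hφ1 : ∫ x, φ x = 1)
    (huc : Continuous u) (hu0 : ∀ ξ, ξ ∉ Icc (-1 : ℝ) 1 → u ξ = 0)
    (hφu : ∀ x, (φ x : ℂ) = (𝓕⁻ u : ℝ → ℂ) x)
    (hc₃0 : 0 ≤ c₃) (hc₃1 : c₃ ≤ 1)
    (H : ∀ α₁ : ℝ, 2 ≤ α₁ → ∀ Y' : Set ℝ, Y' ⊆ Icc (-α₁) α₁ →
        IsRegularSet Y' δ (800 * C_R) 1 α₁ →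
        ∀ t : ℤ → ℝ, (∀ j : ℤ, Icc (t j - (4 * (L : ℝ))⁻¹) (t j + (4 * (L : ℝ))⁻¹) ⊆
          Icc (j : ℝ) ((j : ℝ) + 1)) →
        ∀ h : ℝ → ℂ, Integrable h → MemLp h 2 volume → (∀ ξ, ξ ∉ Y' → h ξ = 0) →
          c₃ * ∫ ξ, ‖h ξ‖ ^ 2 ≤
            ∫ x in ⋃ j : ℤ, Icc (t j - (4 * (L : ℝ))⁻¹) (t j + (4 * (L : ℝ))⁻¹),
              ‖(𝓕⁻ h : ℝ → ℂ) x‖ ^ 2)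
    (hg : Integrable g) (hg2 : MemLp g 2 volume) (hgY : ∀ ξ, ξ ∉ Y → g ξ = 0) (m : ℕ)
    (hm : m = 0 ∨ (L : ℝ) ^ (m * (T + 1) + 1) ≤ N) :
    ∃ gm : ℝ → ℂ, Integrable gm ∧ MemLp gm 2 volume ∧
      (∀ ξ, ξ ∉ Metric.cthickening (2 * (L : ℝ) ^ ((m + 1) * (T + 1))) Y → gm ξ = 0) ∧
      (∀ x, ‖(𝓕⁻ gm : ℝ → ℂ) x‖ ≤ ‖(𝓕⁻ g : ℝ → ℂ) x‖) ∧
      (∀ x ∈ X, (∫ z in Icc (-((L : ℝ) ^ T / 10)) ((L : ℝ) ^ T / 10), φ z) ^ m *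
        ‖(𝓕⁻ g : ℝ → ℂ) x‖ ≤ ‖(𝓕⁻ gm : ℝ → ℂ) x‖) ∧
      ∫ x, ‖(𝓕⁻ gm : ℝ → ℂ) x‖ ^ 2 ≤
        (1 - (1 - (1 - ∫ z in Icc (-((L : ℝ) ^ T / 8)) ((L : ℝ) ^ T / 8), φ z) ^ 2) * c₃) ^ m *
          ∫ x, ‖(𝓕⁻ g : ℝ → ℂ) x‖ ^ 2 := by
  have hL1 : (1 : ℝ) ≤ L := by exact_mod_cast (by omega : 1 ≤ L)
  set mT : ℝ := ∫ z in Icc (-((L : ℝ) ^ T / 10)) ((L : ℝ) ^ T / 10), φ z with hmTdef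
  set mB : ℝ := ∫ z in Icc (-((L : ℝ) ^ T / 8)) ((L : ℝ) ^ T / 8), φ z with hmBdef
  set κ : ℝ := 1 - (1 - (1 - mB) ^ 2) * c₃ with hκdef
  have hmT0 : 0 ≤ mT := integral_nonneg hφ0
  have hmB0 : 0 ≤ mB := integral_nonneg hφ0
  have hmB1 : mB ≤ 1 := mass_Icc_le_one hφ0 hφi hφ1 _
  have hκ0 : 0 ≤ κ := by
    have : (1 - (1 - mB) ^ 2) * c₃ ≤ 1 * 1 := by
      apply mul_le_mul _ hc₃1 hc₃0 zero_le_one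
      nlinarith
    linarith
  induction m with
  | zero =>
    refine ⟨g, hg, hg2, ?_, fun x => le_rfl, ?_, ?_⟩
    · intro ξ hξ
      apply hgY
      intro h
      exact hξ (Metric.self_subset_cthickening Y h)
    · intro x _
      simp
    · simp
  | succ s ih =>
    have hpow : (L : ℝ) ^ ((s + 1) * (T + 1) + 1) ≤ N := by
      rcases hm with h | h
      · exact absurd h (Nat.succ_ne_zero s)
      · exact h
    have hs : s = 0 ∨ (L : ℝ) ^ (s * (T + 1) + 1) ≤ N := by
      right
      calc (L : ℝ) ^ (s * (T + 1) + 1) ≤ (L : ℝ) ^ ((s + 1) * (T + 1) + 1) :=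
            pow_le_pow_right₀ hL1 (by nlinarith)
        _ ≤ N := hpow
    obtain ⟨gs, hgsi, hgs2, hgs0, hgs_le, hgs_ge, hgs_L2⟩ := ih hs
    obtain ⟨g', hg'i, hg'2, hg'0, hg'_le, hg'_ge, hg'_L2⟩ :=
      iteration_step (n := (s + 1) * (T + 1)) (T := T) hδ0 hδ1 hC hL2 hLreg (by nlinarith) hpow
        hXreg hX hYreg hY hφ0 hφi hφ1 huc hu0 hφu H hgsi hgs2 hgs0
    refine ⟨g', hg'i, hg'2, ?_, ?_, ?_, ?_⟩
    · intro ξ hξ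
      apply hg'0
      rwa [show (s + 1) * (T + 1) + 1 + T = (s + 1 + 1) * (T + 1) by ring]
    · exact fun x => (hg'_le x).trans (hgs_le x)
    · intro x hx
      calc mT ^ (s + 1) * ‖(𝓕⁻ g : ℝ → ℂ) x‖ = mT * (mT ^ s * ‖(𝓕⁻ g : ℝ → ℂ) x‖) := by ring
        _ ≤ mT * ‖(𝓕⁻ gs : ℝ → ℂ) x‖ := mul_le_mul_of_nonneg_left (hgs_ge x hx) hmT0
        _ ≤ ‖(𝓕⁻ g' : ℝ → ℂ) x‖ := hg'_ge x hx
    · calc ∫ x, ‖(𝓕⁻ g' : ℝ → ℂ) x‖ ^ 2 ≤ κ * ∫ x, ‖(𝓕⁻ gs : ℝ → ℂ) x‖ ^ 2 := hg'_L2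
        _ ≤ κ * (κ ^ s * ∫ x, ‖(𝓕⁻ g : ℝ → ℂ) x‖ ^ 2) := mul_le_mul_of_nonneg_left hgs_L2 hκ0
        _ = κ ^ (s + 1) * ∫ x, ‖(𝓕⁻ g : ℝ → ℂ) x‖ ^ 2 := by ring

/-- **BD18 Theorem 4 from BD18 Proposition 3.1** (the iteration argument of §3.4, together with the
case `δ < 1/2`, proved). The hypothesis `H` is Proposition 3.1 of Bourgain–Dyatlov 2018 written for
`f = 𝓕⁻ h`, `h ∈ L¹ ∩ L²(ℝ)` vanishing off the regular set `Y` (`‖f‖_{L²} = ‖h‖_{L²}`), with the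
subintervals `I'_j = [t_j - c₁/2, t_j + c₁/2] ⊂ [j, j+1]` and the conclusion squared:
"there exists `c₃ > 0` depending only on `δ, C_R, c₁` such that `c₃ ‖h‖²_{L²} ≤ ‖𝓕⁻ h‖²_{L²(U')}`,
`U' = ⋃_j I'_j`". Given `H`, the named fact `bourgainDyatlov2018_thm4` holds.
[cite: BourgainDyatlov2018, §3.4 (proof of Theorem 4) and Proposition 3.1] -/
theorem bourgainDyatlov2018_thm4_of_prop31
    (H : ∀ (δ C c₁ : ℝ), 0 < δ → δ < 1 → 1 ≤ C → 0 < c₁ → c₁ ≤ 1 →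
      ∃ c₃ : ℝ, 0 < c₃ ∧ ∀ α₁ : ℝ, 2 ≤ α₁ → ∀ Y : Set ℝ, Y ⊆ Icc (-α₁) α₁ →
        IsRegularSet Y δ C 1 α₁ →
        ∀ t : ℤ → ℝ, (∀ j : ℤ, Icc (t j - c₁ / 2) (t j + c₁ / 2) ⊆ Icc (j : ℝ) ((j : ℝ) + 1)) →
        ∀ h : ℝ → ℂ, Integrable h → MemLp h 2 volume → (∀ ξ, ξ ∉ Y → h ξ = 0) →
          c₃ * ∫ ξ, ‖h ξ‖ ^ 2 ≤
            ∫ x in ⋃ j : ℤ, Icc (t j - c₁ / 2) (t j + c₁ / 2), ‖(𝓕⁻ h : ℝ → ℂ) x‖ ^ 2) :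
    bourgainDyatlov2018_thm4 := by
  intro δ C_R hδ0 hδ1 hC
  by_cases hhalf : δ < 1 / 2
  · exact bourgainDyatlov2018_thm4_of_lt_half δ C_R hδ0 hhalf hC
  push Not at hhalf
  have hδpos : 0 < δ := by linarith
  -- the base `L = ⌈(3 C_R)^{2/(1-δ)}⌉`
  set L : ℕ := ⌈(3 * C_R) ^ (2 / (1 - δ))⌉₊ with hLdef
  have hLreg : (3 * C_R) ^ (2 / (1 - δ)) ≤ (L : ℝ) := Nat.le_ceil _
  have h9 : (9 : ℝ) ≤ (3 * C_R) ^ (2 / (1 - δ)) := by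
    have h1 : (3 * C_R) ^ (2 : ℝ) ≤ (3 * C_R) ^ (2 / (1 - δ)) := by
      apply Real.rpow_le_rpow_of_exponent_le (by linarith)
      rw [le_div_iff₀ (by linarith)]
      nlinarith
    rw [Real.rpow_two] at h1
    nlinarith
  have hL2 : 2 ≤ L := by
    have : (2 : ℝ) ≤ L := by linarith
    exact_mod_cast this
  have hL1 : (1 : ℝ) < L := by exact_mod_cast (by omega : 1 < L)
  have hLpos : (0 : ℝ) < L := by linarith
  -- the kernel `φ = 𝓕⁻ u`
  obtain ⟨φ, u, hφ0, -, hφi, hφ1, huc, -, hu0, hφu⟩ := exists_bandlimitedKernel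
  -- Proposition 3.1 at `(δ, 800 C_R, c₁ = 1/(2L))`, with `c₃` capped at `1`
  obtain ⟨c₃', hc₃'pos, Hc'⟩ := H δ (800 * C_R) (2 * (4 * (L : ℝ))⁻¹) hδpos hδ1 (by linarith)
    (by positivity) (by
      rw [show (2 : ℝ) * (4 * (L : ℝ))⁻¹ = (2 * (L : ℝ))⁻¹ by field_simp; norm_num]
      exact inv_le_one_of_one_le₀ (by linarith))
  have hhalfw : (2 * (4 * (L : ℝ))⁻¹) / 2 = (4 * (L : ℝ))⁻¹ := by ring
  simp only [hhalfw] at Hc'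
  set c₃ : ℝ := min c₃' 1 with hc₃def
  have hc₃pos : 0 < c₃ := lt_min hc₃'pos one_pos
  have hc₃1 : c₃ ≤ 1 := min_le_right _ _
  have Hc : ∀ α₁ : ℝ, 2 ≤ α₁ → ∀ Y' : Set ℝ, Y' ⊆ Icc (-α₁) α₁ →
      IsRegularSet Y' δ (800 * C_R) 1 α₁ →
      ∀ t : ℤ → ℝ, (∀ j : ℤ, Icc (t j - (4 * (L : ℝ))⁻¹) (t j + (4 * (L : ℝ))⁻¹) ⊆
        Icc (j : ℝ) ((j : ℝ) + 1)) →
      ∀ h : ℝ → ℂ, Integrable h → MemLp h 2 volume → (∀ ξ, ξ ∉ Y' → h ξ = 0) →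
        c₃ * ∫ ξ, ‖h ξ‖ ^ 2 ≤
          ∫ x in ⋃ j : ℤ, Icc (t j - (4 * (L : ℝ))⁻¹) (t j + (4 * (L : ℝ))⁻¹),
            ‖(𝓕⁻ h : ℝ → ℂ) x‖ ^ 2 := by
    intro α₁ hα₁ Y' hY' hY'reg t ht h hh hh2 hh0
    have := Hc' α₁ hα₁ Y' hY' hY'reg t ht h hh hh2 hh0
    have hI : 0 ≤ ∫ ξ, ‖h ξ‖ ^ 2 := integral_nonneg fun _ => by positivity
    calc c₃ * ∫ ξ, ‖h ξ‖ ^ 2 ≤ c₃' * ∫ ξ, ‖h ξ‖ ^ 2 :=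
          mul_le_mul_of_nonneg_right (min_le_left _ _) hI
      _ ≤ _ := this
  -- tails of the kernel fix `T`
  obtain ⟨R₀, hR₀pos, hR₀⟩ := exists_mass_Icc_ge hφ0 hφi hφ1 (ε := c₃ / 8) (by positivity)
  obtain ⟨T, hT⟩ := pow_unbounded_of_one_lt (10 * R₀) hL1
  set mT : ℝ := ∫ z in Icc (-((L : ℝ) ^ T / 10)) ((L : ℝ) ^ T / 10), φ z with hmTdef
  set mB : ℝ := ∫ z in Icc (-((L : ℝ) ^ T / 8)) ((L : ℝ) ^ T / 8), φ z with hmBdef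
  have hmT : 1 - c₃ / 8 ≤ mT := hR₀ _ (by linarith)
  have hmB : 1 - c₃ / 8 ≤ mB := hR₀ _ (by linarith)
  have hmB1 : mB ≤ 1 := mass_Icc_le_one hφ0 hφi hφ1 _
  have hmT1 : mT ≤ 1 := mass_Icc_le_one hφ0 hφi hφ1 _
  set κ : ℝ := 1 - (1 - (1 - mB) ^ 2) * c₃ with hκdef
  set θ₀ : ℝ := 1 - c₃ / 2 with hθdef
  have hθ0 : 0 < θ₀ := by linarith
  have hθ1 : θ₀ < 1 := by linarith
  have hmTpos : 0 < mT := by linarith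
  have hκ0 : 0 ≤ κ := by
    have : (1 - (1 - mB) ^ 2) * c₃ ≤ 1 * 1 := by
      apply mul_le_mul _ hc₃1 hc₃pos.le zero_le_one
      nlinarith
    linarith
  -- the key ratio `κ ≤ θ₀ m_T²` (BD18 (3.31): `(1 - C_φ L^{1-T})⁻¹ (1-τ) ≤ 1 - τ/2`)
  have hratio : κ ≤ θ₀ * mT ^ 2 := by
    have h1 : κ ≤ 1 - 3 / 4 * c₃ := by
      have hb : (1 - mB) ^ 2 ≤ 1 / 64 := by nlinarith
      have : (3 / 4 : ℝ) * c₃ ≤ (1 - (1 - mB) ^ 2) * c₃ := by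
        apply mul_le_mul_of_nonneg_right _ hc₃pos.le; linarith
      linarith
    have h2 : (1 - c₃ / 8) ^ 2 ≤ mT ^ 2 := pow_le_pow_left₀ (by linarith) hmT 2
    have h3 : 1 - 3 / 4 * c₃ ≤ θ₀ * (1 - c₃ / 8) ^ 2 := by
      have e : θ₀ * (1 - c₃ / 8) ^ 2 - (1 - 3 / 4 * c₃) = c₃ ^ 2 * (18 - c₃) / 128 := by
        rw [hθdef]; ring
      have : 0 ≤ c₃ ^ 2 * (18 - c₃) / 128 := by
        apply div_nonneg _ (by norm_num)
        exact mul_nonneg (sq_nonneg _) (by linarith)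
      linarith
    calc κ ≤ 1 - 3 / 4 * c₃ := h1
      _ ≤ θ₀ * (1 - c₃ / 8) ^ 2 := h3
      _ ≤ θ₀ * mT ^ 2 := mul_le_mul_of_nonneg_left h2 hθ0.le
  -- exponent `β` and constant `C`
  have hlogL : 0 < Real.log L := Real.log_pos hL1
  have hlogθ : Real.log θ₀ < 0 := Real.log_neg hθ0 hθ1
  set β : ℝ := -Real.log θ₀ / (2 * ((T : ℝ) + 1) * Real.log L) with hβdef
  have hβpos : 0 < β := div_pos (neg_pos.2 hlogθ) (by positivity)
  refine ⟨β, hβpos, θ₀⁻¹, ?_⟩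
  intro N hN X Y hX hY hXreg hYreg g hg2 hgY
  have hNpos : 0 < N := by linarith
  -- `g ∈ L¹`
  have hg : Integrable g := by
    have hYb : volume Y < ⊤ := ((Metric.isBounded_Icc (-N) N).subset hY).measure_lt_top
    exact memLp_one_iff_integrable.1
      (hg2.mono_exponent_of_measure_support_ne_top hgY hYb.ne (by norm_num))
  -- number of steps `m ~ log N / ((T+1) log L)`
  set m : ℕ := ⌊(Real.logb L N - 1) / ((T : ℝ) + 1)⌋₊ with hmdef
  have hm : m = 0 ∨ (L : ℝ) ^ (m * (T + 1) + 1) ≤ N := by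
    by_cases hm0 : m = 0
    · exact Or.inl hm0
    right
    have hq : 0 ≤ (Real.logb L N - 1) / ((T : ℝ) + 1) := by
      by_contra hneg
      push Not at hneg
      exact hm0 (Nat.floor_eq_zero.2 (by linarith))
    have hmle : (m : ℝ) ≤ (Real.logb L N - 1) / ((T : ℝ) + 1) := Nat.floor_le hq
    have h1 : (m : ℝ) * ((T : ℝ) + 1) + 1 ≤ Real.logb L N := by
      rw [le_div_iff₀ (by positivity)] at hmle
      linarith
    have h2 : (L : ℝ) ^ ((m : ℝ) * ((T : ℝ) + 1) + 1) ≤ N :=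
      (Real.le_logb_iff_rpow_le hL1 hNpos).1 h1
    have e : ((m * (T + 1) + 1 : ℕ) : ℝ) = (m : ℝ) * ((T : ℝ) + 1) + 1 := by push_cast; ring
    rw [← Real.rpow_natCast, e]
    exact h2
  obtain ⟨gm, hgmi, hgm2, -, -, hgm_ge, hgm_L2⟩ := iteration_many hδ0 hδ1 hC hL2 hLreg hXreg hX
    hYreg hY hφ0 hφi hφ1 huc hu0 hφu hc₃pos.le hc₃1 Hc hg hg2 hgY m hm
  -- from the pointwise lower bound on `X` and the `L²` bound (BD18 (3.30))
  set F : ℝ → ℝ := fun x => ‖(𝓕⁻ g : ℝ → ℂ) x‖ ^ 2 with hFdef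
  set G : ℝ → ℝ := fun x => ‖(𝓕⁻ gm : ℝ → ℂ) x‖ ^ 2 with hGdef
  have hFi : Integrable F := integrable_norm_sq_fourierInv hg hg2
  have hGi : Integrable G := integrable_norm_sq_fourierInv hgmi hgm2
  have hPl : ∫ x, F x = ∫ ξ, ‖g ξ‖ ^ 2 := integral_norm_sq_fourierInv_eq hg hg2
  have hXm : MeasurableSet X := hXreg.2.1.measurableSet
  have hpm : 0 < mT ^ m := pow_pos hmTpos m
  have hstepX : ∫ x in X, F x ≤ ∫ x in X, (mT ^ m)⁻¹ ^ 2 * G x := by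
    apply setIntegral_mono_on hFi.integrableOn (hGi.const_mul _).integrableOn hXm
    intro x hx
    have h := hgm_ge x hx
    have h' : ‖(𝓕⁻ g : ℝ → ℂ) x‖ ≤ (mT ^ m)⁻¹ * ‖(𝓕⁻ gm : ℝ → ℂ) x‖ := by
      rw [le_inv_mul_iff₀ hpm]; exact h
    calc F x = ‖(𝓕⁻ g : ℝ → ℂ) x‖ ^ 2 := rfl
      _ ≤ ((mT ^ m)⁻¹ * ‖(𝓕⁻ gm : ℝ → ℂ) x‖) ^ 2 := pow_le_pow_left₀ (norm_nonneg _) h' 2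
      _ = (mT ^ m)⁻¹ ^ 2 * G x := by rw [mul_pow]
  have hGX : ∫ x in X, G x ≤ ∫ x, G x :=
    setIntegral_le_integral hGi (Eventually.of_forall fun x => by positivity)
  have hF0 : 0 ≤ ∫ x, F x := integral_nonneg fun x => by positivity
  have hchain : ∫ x in X, F x ≤ ((mT ^ m)⁻¹ ^ 2 * κ ^ m) * ∫ x, F x := by
    calc ∫ x in X, F x ≤ ∫ x in X, (mT ^ m)⁻¹ ^ 2 * G x := hstepX
      _ = (mT ^ m)⁻¹ ^ 2 * ∫ x in X, G x := integral_const_mul _ _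
      _ ≤ (mT ^ m)⁻¹ ^ 2 * ∫ x, G x := mul_le_mul_of_nonneg_left hGX (by positivity)
      _ ≤ (mT ^ m)⁻¹ ^ 2 * (κ ^ m * ∫ x, F x) := mul_le_mul_of_nonneg_left hgm_L2 (by positivity)
      _ = ((mT ^ m)⁻¹ ^ 2 * κ ^ m) * ∫ x, F x := by ring
  -- `m_T^{-2m} κ^m ≤ θ₀^m`
  have hratio' : (mT ^ m)⁻¹ ^ 2 * κ ^ m ≤ θ₀ ^ m := by
    have e : (mT ^ m)⁻¹ ^ 2 * κ ^ m = (κ / mT ^ 2) ^ m := by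
      rw [div_pow, ← pow_mul, inv_pow, ← pow_mul, mul_comm m 2, div_eq_mul_inv, mul_comm]
    rw [e]
    apply pow_le_pow_left₀ (div_nonneg hκ0 (sq_nonneg _))
    rw [div_le_iff₀ (by positivity)]
    exact hratio
  -- `θ₀^m ≤ θ₀⁻² N^{-2β}` (BD18: "Taking `m` such that `L^{(m-1)T+1} ≤ N ≤ L^{mT+1}`")
  have hexp : θ₀ ^ m ≤ θ₀⁻¹ ^ 2 * N ^ (-(2 * β)) := by
    have hq : Real.logb L N / ((T : ℝ) + 1) - 2 ≤ (m : ℝ) := by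
      have hlt := Nat.lt_floor_add_one ((Real.logb L N - 1) / ((T : ℝ) + 1))
      have e : (Real.logb L N - 1) / ((T : ℝ) + 1) =
          Real.logb L N / ((T : ℝ) + 1) - 1 / ((T : ℝ) + 1) := by ring
      have h1T : 1 / ((T : ℝ) + 1) ≤ 1 := by
        rw [div_le_one (by positivity)]; linarith [T.cast_nonneg (α := ℝ)]
      have : (⌊(Real.logb L N - 1) / ((T : ℝ) + 1)⌋₊ : ℝ) = m := by rw [hmdef]
      linarith
    have h1 : θ₀ ^ (m : ℝ) ≤ θ₀ ^ (Real.logb L N / ((T : ℝ) + 1) - 2) :=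
      Real.rpow_le_rpow_of_exponent_ge hθ0 hθ1.le hq
    rw [Real.rpow_natCast] at h1
    have h2 : θ₀ ^ (Real.logb L N / ((T : ℝ) + 1) - 2) = θ₀⁻¹ ^ 2 * N ^ (-(2 * β)) := by
      rw [Real.rpow_sub hθ0, Real.rpow_two, inv_pow, div_eq_mul_inv, mul_comm]
      congr 1
      rw [Real.rpow_def_of_pos hθ0, Real.rpow_def_of_pos hNpos, hβdef, Real.logb]
      congr 1
      field_simp
    linarith
  -- assemble
  have hN2β : (N : ℝ) ^ (-(2 * β)) = (N ^ (-β)) ^ 2 := by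
    rw [← Real.rpow_natCast, ← Real.rpow_mul hNpos.le]
    congr 1
    push_cast
    ring
  have main : ∫ x in X, F x ≤ (θ₀⁻¹ * N ^ (-β)) ^ 2 * ∫ ξ, ‖g ξ‖ ^ 2 := by
    calc ∫ x in X, F x ≤ ((mT ^ m)⁻¹ ^ 2 * κ ^ m) * ∫ x, F x := hchain
      _ ≤ θ₀ ^ m * ∫ x, F x := mul_le_mul_of_nonneg_right hratio' hF0
      _ ≤ (θ₀⁻¹ ^ 2 * N ^ (-(2 * β))) * ∫ x, F x := mul_le_mul_of_nonneg_right hexp hF0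
      _ = (θ₀⁻¹ * N ^ (-β)) ^ 2 * ∫ ξ, ‖g ξ‖ ^ 2 := by rw [hPl, hN2β, mul_pow]
  exact main

end Literature.Analysis.Fourier
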